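import Summits.Ventures.DiscreteObjects.Hadamard.CyclotomicClassParity

/-!
# H(668), automorphisms with `g¹² = 1`: the mod-167 code parities of the 12-, 6- and 4-cycles (kernel)

Framing: lottery ticket; floor = certified bounds/negative ranges.

Cell pub-namedobj (venture DiscreteObjects), target (H), hadamard gen 15.  HANDOFF-H-g14 open item 2 asked for an ORDER-12
refinement ('`a₁₂ + [δ = −1]·a₆` is even').  It is an instance of the cyclotomic class theorem (`CyclotomicClassParity`):
`167 ≡ −1 (mod 24)`, `(mod 12)`, `(mod 8)`, so for every Hadamard matrix of order `668` and every signed automorphism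
`(π, κ, d, e)` with `κ¹² = 1` pointwise (`hadamard668_aut_pow_twelve_code_parity`):
* (`m = 24`) the number of NEGA `12`-cycles of `κ` is even;
* (`m = 12`) (number of PLAIN `12`-cycles) + (number of NEGA `6`-cycles) is even;
* (`m = 8`)  (number of NEGA `4`-cycles) + (number of NEGA `12`-cycles) is even — hence the nega `4`-cycles are even too.
Here '`j` lies on an `L`-cycle' is `Function.minimalPeriod κ j = L`, the cycle sign is `∏_{i<L} e(κ^i j)`, and each count is
`#points / L`.  Consequently the total number of `12`-cycles has the parity of the number of nega `6`-cycles (gen 14's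
`a₁₂ + [δ = −1] a₆ ≡ 0`).  Rows likewise (apply to `Hᵀ`).  PARITY only; no order excluded.  Ours; no `sorry`.
-/

open Polynomial Finset BigOperators Matrix

namespace Summit.Ventures.DiscreteObjects.Hadamard

open Literature.Combinatorics.Designs.GoethalsSeidel (IsHadamardMatrix)

variable {ι : Type*} [Fintype ι] [DecidableEq ι]

/-- **H(668), `κ¹² = 1`: nega 12-cycles even; plain 12-cycles + nega 6-cycles even; nega 4-cycles + nega 12-cycles even.** -/
theorem hadamard668_aut_pow_twelve_code_parity {H : Matrix ι ι ℤ} (hH : IsHadamardMatrix H)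
    (hι : Fintype.card ι = 668) {π κ : Equiv.Perm ι} {d e : ι → ℤ} (haut : IsSignedAut H π κ d e)
    (hκ : ∀ j, (κ ^ 12) j = j) :
    (2 ∣ (univ.filter (fun j => Function.minimalPeriod κ j = 12 ∧ ∏ i ∈ range 12, e ((κ ^ i) j) = -1)).card / 12) ∧
    (2 ∣ (univ.filter (fun j => Function.minimalPeriod κ j = 6 ∧ ∏ i ∈ range 6, e ((κ ^ i) j) = -1)).card / 6 +
      (univ.filter (fun j => Function.minimalPeriod κ j = 12 ∧ ∏ i ∈ range 12, e ((κ ^ i) j) = 1)).card / 12) ∧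
    (2 ∣ (univ.filter (fun j => Function.minimalPeriod κ j = 4 ∧ ∏ i ∈ range 4, e ((κ ^ i) j) = -1)).card / 4 +
      (univ.filter (fun j => Function.minimalPeriod κ j = 12 ∧ ∏ i ∈ range 12, e ((κ ^ i) j) = -1)).card / 12) := by
  have he := haut.2.1
  -- periods divide 12 and are positive
  have hP : ∀ j, Function.IsPeriodicPt κ 12 j := fun j => by
    rw [Function.IsPeriodicPt, Function.IsFixedPt, Equiv.Perm.iterate_eq_pow]
    exact hκ j
  have hLdvd : ∀ j, Function.minimalPeriod κ j ∣ 12 := fun j => (hP j).minimalPeriod_dvd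
  have hLpos : ∀ j, 0 < Function.minimalPeriod κ j := fun j => (hP j).minimalPeriod_pos (by norm_num)
  have hpm : ∀ j L, ∏ i ∈ range L, e ((κ ^ i) j) = 1 ∨ ∏ i ∈ range L, e ((κ ^ i) j) = -1 :=
    fun j L => prod_range_pm' (fun t => he ((κ ^ t) j)) L
  -- the generic summand
  have hterm : ∀ (m L : ℕ), L ∈ range 13 →
      (∀ j, Function.minimalPeriod κ j = L →
        ¬ ((∏ i ∈ range L, e ((κ ^ i) j) = 1 ∧ m ∣ L) ∨
           (∏ i ∈ range L, e ((κ ^ i) j) = -1 ∧ m ∣ 2 * L ∧ ¬ m ∣ L))) →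
      (univ.filter (fun j => Function.minimalPeriod κ j = L ∧
        ((∏ i ∈ range L, e ((κ ^ i) j) = 1 ∧ m ∣ L) ∨
         (∏ i ∈ range L, e ((κ ^ i) j) = -1 ∧ m ∣ 2 * L ∧ ¬ m ∣ L)))).card / L = 0 := by
    intro m L _ hno
    rw [Finset.card_eq_zero.mpr, Nat.zero_div]
    rw [Finset.filter_eq_empty_iff]
    intro j _ hP
    exact hno j hP.1 hP.2
  refine ⟨?_, ?_, ?_⟩
  · -- m = 24: only the nega 12-cycles carry Φ₂₄
    have h := hadamard668_signedAut_cyclotomic_cycles_even hH hι haut (M := 12) (by norm_num) hκ (by norm_num)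
      (m := 24) (j₀ := 1) (by norm_num) ⟨1, by norm_num⟩ (by norm_num)
    rw [Finset.sum_eq_single 12] at h
    · have e12 : (univ.filter (fun j => Function.minimalPeriod κ j = 12 ∧
          ((∏ i ∈ range 12, e ((κ ^ i) j) = 1 ∧ 24 ∣ 12) ∨
           (∏ i ∈ range 12, e ((κ ^ i) j) = -1 ∧ 24 ∣ 2 * 12 ∧ ¬ 24 ∣ 12)))) =
          univ.filter (fun j => Function.minimalPeriod κ j = 12 ∧ ∏ i ∈ range 12, e ((κ ^ i) j) = -1) := by
        apply Finset.filter_congr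
        intro j _
        constructor
        · rintro ⟨hp, (⟨-, h24⟩ | ⟨hs, -, -⟩)⟩
          · omega
          · exact ⟨hp, hs⟩
        · rintro ⟨hp, hs⟩
          exact ⟨hp, Or.inr ⟨hs, by norm_num, by norm_num⟩⟩
      rwa [e12] at h
    · intro L hL hL12
      apply hterm 24 L hL
      intro j hp hc
      have hd := hLdvd j
      have h0 := hLpos j
      rw [hp] at hd h0
      rw [mem_range] at hL
      interval_cases L <;> omega
    · intro h13
      exact absurd (mem_range.mpr (by norm_num)) h13
  · -- m = 12: plain 12-cycles and nega 6-cycles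
    have h := hadamard668_signedAut_cyclotomic_cycles_even hH hι haut (M := 12) (by norm_num) hκ (by norm_num)
      (m := 12) (j₀ := 1) (by norm_num) ⟨2, by norm_num⟩ (by norm_num)
    rw [Finset.sum_eq_add 6 12 (by norm_num)] at h
    · have e6 : (univ.filter (fun j => Function.minimalPeriod κ j = 6 ∧
          ((∏ i ∈ range 6, e ((κ ^ i) j) = 1 ∧ 12 ∣ 6) ∨
           (∏ i ∈ range 6, e ((κ ^ i) j) = -1 ∧ 12 ∣ 2 * 6 ∧ ¬ 12 ∣ 6)))) =
          univ.filter (fun j => Function.minimalPeriod κ j = 6 ∧ ∏ i ∈ range 6, e ((κ ^ i) j) = -1) := by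
        apply Finset.filter_congr
        intro j _
        constructor
        · rintro ⟨hp, (⟨-, h12⟩ | ⟨hs, -, -⟩)⟩
          · omega
          · exact ⟨hp, hs⟩
        · rintro ⟨hp, hs⟩
          exact ⟨hp, Or.inr ⟨hs, by norm_num, by norm_num⟩⟩
      have e12 : (univ.filter (fun j => Function.minimalPeriod κ j = 12 ∧
          ((∏ i ∈ range 12, e ((κ ^ i) j) = 1 ∧ 12 ∣ 12) ∨
           (∏ i ∈ range 12, e ((κ ^ i) j) = -1 ∧ 12 ∣ 2 * 12 ∧ ¬ 12 ∣ 12)))) =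
          univ.filter (fun j => Function.minimalPeriod κ j = 12 ∧ ∏ i ∈ range 12, e ((κ ^ i) j) = 1) := by
        apply Finset.filter_congr
        intro j _
        constructor
        · rintro ⟨hp, (⟨hs, -⟩ | ⟨-, -, h12⟩)⟩
          · exact ⟨hp, hs⟩
          · exact absurd (dvd_refl 12) h12
        · rintro ⟨hp, hs⟩
          exact ⟨hp, Or.inl ⟨hs, dvd_refl 12⟩⟩
      rwa [e6, e12] at h
    · intro L hL hne
      apply hterm 12 L hL
      intro j hp hc
      have hd := hLdvd j
      have h0 := hLpos j
      rw [hp] at hd h0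
      rw [mem_range] at hL
      obtain ⟨hL6, hL12⟩ := hne
      interval_cases L <;> omega
    · intro h6
      exact absurd (mem_range.mpr (by norm_num)) h6
    · intro h12
      exact absurd (mem_range.mpr (by norm_num)) h12
  · -- m = 8: nega 4-cycles and nega 12-cycles
    have h := hadamard668_signedAut_cyclotomic_cycles_even hH hι haut (M := 12) (by norm_num) hκ (by norm_num)
      (m := 8) (j₀ := 1) (by norm_num) ⟨3, by norm_num⟩ (by norm_num)
    rw [Finset.sum_eq_add 4 12 (by norm_num)] at h
    · have e4 : (univ.filter (fun j => Function.minimalPeriod κ j = 4 ∧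
          ((∏ i ∈ range 4, e ((κ ^ i) j) = 1 ∧ 8 ∣ 4) ∨
           (∏ i ∈ range 4, e ((κ ^ i) j) = -1 ∧ 8 ∣ 2 * 4 ∧ ¬ 8 ∣ 4)))) =
          univ.filter (fun j => Function.minimalPeriod κ j = 4 ∧ ∏ i ∈ range 4, e ((κ ^ i) j) = -1) := by
        apply Finset.filter_congr
        intro j _
        constructor
        · rintro ⟨hp, (⟨-, h8⟩ | ⟨hs, -, -⟩)⟩
          · omega
          · exact ⟨hp, hs⟩
        · rintro ⟨hp, hs⟩
          exact ⟨hp, Or.inr ⟨hs, by norm_num, by norm_num⟩⟩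
      have e12 : (univ.filter (fun j => Function.minimalPeriod κ j = 12 ∧
          ((∏ i ∈ range 12, e ((κ ^ i) j) = 1 ∧ 8 ∣ 12) ∨
           (∏ i ∈ range 12, e ((κ ^ i) j) = -1 ∧ 8 ∣ 2 * 12 ∧ ¬ 8 ∣ 12)))) =
          univ.filter (fun j => Function.minimalPeriod κ j = 12 ∧ ∏ i ∈ range 12, e ((κ ^ i) j) = -1) := by
        apply Finset.filter_congr
        intro j _
        constructor
        · rintro ⟨hp, (⟨-, h8⟩ | ⟨hs, -, -⟩)⟩
          · omega
          · exact ⟨hp, hs⟩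
        · rintro ⟨hp, hs⟩
          exact ⟨hp, Or.inr ⟨hs, by norm_num, by norm_num⟩⟩
      rwa [e4, e12] at h
    · intro L hL hne
      apply hterm 8 L hL
      intro j hp hc
      have hd := hLdvd j
      have h0 := hLpos j
      rw [hp] at hd h0
      rw [mem_range] at hL
      obtain ⟨hL4, hL12⟩ := hne
      interval_cases L <;> omega
    · intro h4
      exact absurd (mem_range.mpr (by norm_num)) h4
    · intro h12
      exact absurd (mem_range.mpr (by norm_num)) h12

/-- **Rows**: the same for `(π, d)` when `π¹² = 1` (the column theorem for `Hᵀ`). -/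
theorem hadamard668_aut_pow_twelve_code_parity_row {H : Matrix ι ι ℤ} (hH : IsHadamardMatrix H)
    (hι : Fintype.card ι = 668) {π κ : Equiv.Perm ι} {d e : ι → ℤ} (haut : IsSignedAut H π κ d e)
    (hπ : ∀ i, (π ^ 12) i = i) :
    (2 ∣ (univ.filter (fun i => Function.minimalPeriod π i = 12 ∧ ∏ t ∈ range 12, d ((π ^ t) i) = -1)).card / 12) ∧
    (2 ∣ (univ.filter (fun i => Function.minimalPeriod π i = 6 ∧ ∏ t ∈ range 6, d ((π ^ t) i) = -1)).card / 6 +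
      (univ.filter (fun i => Function.minimalPeriod π i = 12 ∧ ∏ t ∈ range 12, d ((π ^ t) i) = 1)).card / 12) ∧
    (2 ∣ (univ.filter (fun i => Function.minimalPeriod π i = 4 ∧ ∏ t ∈ range 4, d ((π ^ t) i) = -1)).card / 4 +
      (univ.filter (fun i => Function.minimalPeriod π i = 12 ∧ ∏ t ∈ range 12, d ((π ^ t) i) = -1)).card / 12) := by
  have hcardι : (Fintype.card ι : ℤ) ≠ 0 := by rw [hι]; norm_num
  exact hadamard668_aut_pow_twelve_code_parity (isHadamard_transpose hH hcardι) hι (isSignedAut_transpose haut) hπ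

end Summit.Ventures.DiscreteObjects.Hadamard
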